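import Summits.Ventures.PercRepro.Reduced

/-!
# PercRepro — WLOG two-terminal-reduced for LEMMA 5 itself (mark-incident free edges) (typer-2, gen 4)

`Reduced.lean` reduces the every-edge concavity lemma to reduced instances. For LEMMA 5 in free-edge
form (`Concavity5Sure`: `g` free with an endpoint joined by SURE edges to a mark) the substitutions
must also preserve sure-connectivity — they do: the sure configuration of the substituted weights is
the merged / reduced sure configuration (`sureConfig_parWeight`, `sureConfig_serWeight`), and
connectivity transports (`conn_mergePar_iff`, `IsSeries.conn_iff`). Hence

* `sureConn_parWeight_iff`, `IsSeries.sureConn_iff`;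
* **`Concavity5SureReduced`** (Lemma 5 asked only of instances without a reducible pair) and
  **`Concavity5Sure_of_reduced : Concavity5SureReduced → Concavity5Sure`**, with
  `C011_of_Concavity5SureReduced`, `C005_of_Concavity5SureReduced`.
-/

namespace PercRepro

namespace MultiGraph

variable {V E : Type*} (G : MultiGraph V E) [DecidableEq E]

/-- Merging a parallel pair into `e₁` (`e₁ ↦ ω e₁ ∨ ω e₂`, `e₂ ↦ false`) preserves open adjacency. -/
theorem openAdj_mergePar_iff {e₁ e₂ : E} (hne : e₁ ≠ e₂) (hpar : G.Parallel e₁ e₂) (ω : Config E)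
    (x y : V) :
    G.OpenAdj (Function.update (Function.update ω e₂ false) e₁ (ω e₁ || ω e₂)) x y ↔
      G.OpenAdj ω x y := by
  constructor
  · rintro ⟨e, he, hend⟩
    by_cases he₁ : e = e₁
    · subst he₁
      rw [Function.update_self, Bool.or_eq_true] at he
      rcases he with h | h
      · exact ⟨e, h, hend⟩
      · exact ⟨e₂, h, (hpar.endpoints_iff G x y).mp hend⟩
    by_cases he₂ : e = e₂
    · subst he₂
      rw [Function.update_of_ne hne.symm, Function.update_self] at he
      exact absurd he Bool.false_ne_true
    · rw [Function.update_of_ne he₁, Function.update_of_ne he₂] at he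
      exact ⟨e, he, hend⟩
  · rintro ⟨e, he, hend⟩
    by_cases he₁ : e = e₁
    · subst he₁
      refine ⟨e, ?_, hend⟩
      rw [Function.update_self, he, Bool.true_or]
    by_cases he₂ : e = e₂
    · subst he₂
      refine ⟨e₁, ?_, (hpar.endpoints_iff G x y).mpr hend⟩
      rw [Function.update_self, he, Bool.or_true]
    · refine ⟨e, ?_, hend⟩
      rw [Function.update_of_ne he₁, Function.update_of_ne he₂]
      exact he

/-- Merging a parallel pair preserves connectivity. -/
theorem conn_mergePar_iff {e₁ e₂ : E} (hne : e₁ ≠ e₂) (hpar : G.Parallel e₁ e₂) (ω : Config E)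
    (x y : V) :
    G.Conn (Function.update (Function.update ω e₂ false) e₁ (ω e₁ || ω e₂)) x y ↔
      G.Conn ω x y :=
  G.conn_congr_of_openAdj_iff (fun x y => G.openAdj_mergePar_iff hne hpar ω x y) x y

end MultiGraph

section SureConfig

variable {E : Type*} [DecidableEq E]

/-- The sure configuration of the parallel substitution is the merged sure configuration. -/
theorem sureConfig_parWeight {p : E → ℝ} (hp : IsProb p) {e₁ e₂ : E} (hne : e₁ ≠ e₂) :
    sureConfig (parWeight p e₁ e₂) =
      Function.update (Function.update (sureConfig p) e₂ false) e₁
        (sureConfig p e₁ || sureConfig p e₂) := by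
  funext e
  by_cases he₁ : e = e₁
  · subst he₁
    rw [Function.update_self]
    unfold sureConfig parWeight
    rw [Function.update_self, ← Bool.decide_or]
    refine decide_eq_decide.mpr ?_
    have h1 := hp.le_one e
    have h2 := hp.le_one e₂
    constructor
    · intro h
      have : (1 - p e) * (1 - p e₂) = 0 := by linarith
      rcases mul_eq_zero.mp this with h' | h'
      · exact Or.inl (by linarith)
      · exact Or.inr (by linarith)
    · rintro (h | h)
      · rw [h]
        ring
      · rw [h]
        ring
  by_cases he₂ : e = e₂
  · subst he₂
    rw [Function.update_of_ne hne.symm, Function.update_self]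
    unfold sureConfig parWeight
    rw [Function.update_of_ne hne.symm, Function.update_self]
    simp
  · rw [Function.update_of_ne he₁, Function.update_of_ne he₂]
    unfold sureConfig parWeight
    rw [Function.update_of_ne he₁, Function.update_of_ne he₂]

/-- The sure configuration of the series substitution is the reduced sure configuration. -/
theorem sureConfig_serWeight {p : E → ℝ} (hp : IsProb p) {e₁ e₂ : E} (hne : e₁ ≠ e₂) :
    sureConfig (serWeight p e₁ e₂) = serConfig e₁ e₂ (sureConfig p) := by
  funext e
  by_cases he₁ : e = e₁
  · subst he₁
    rw [serConfig_apply_fst]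
    unfold sureConfig serWeight
    rw [Function.update_self, ← Bool.decide_and]
    refine decide_eq_decide.mpr ?_
    have h1 := hp.le_one e
    have h2 := hp.le_one e₂
    have h3 := hp.nonneg e
    have h4 := hp.nonneg e₂
    constructor
    · intro h
      constructor
      · nlinarith
      · nlinarith
    · rintro ⟨h, h'⟩
      rw [h, h']
      ring
  by_cases he₂ : e = e₂
  · subst he₂
    rw [serConfig_apply_snd hne]
    unfold sureConfig serWeight
    rw [Function.update_of_ne hne.symm, Function.update_self]
    simp
  · rw [serConfig_apply_of_ne _ he₁ he₂]
    unfold sureConfig serWeight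
    rw [Function.update_of_ne he₁, Function.update_of_ne he₂]

end SureConfig

namespace MultiGraph

variable {V E : Type*} {G : MultiGraph V E} [DecidableEq E]

/-- Sure-connectivity is unchanged by the parallel substitution. -/
theorem sureConn_parWeight_iff {p : E → ℝ} (hp : IsProb p) {e₁ e₂ : E} (hne : e₁ ≠ e₂)
    (hpar : G.Parallel e₁ e₂) (x y : V) :
    G.SureConn (parWeight p e₁ e₂) x y ↔ G.SureConn p x y := by
  unfold SureConn
  rw [sureConfig_parWeight hp hne]
  exact G.conn_mergePar_iff hne hpar _ x y

/-- Sure-connectivity between vertices other than `x` transports along the series substitution. -/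
theorem IsSeries.sureConn_iff {e₁ e₂ : E} {x y z : V} (hs : G.IsSeries e₁ e₂ x y z) {p : E → ℝ}
    (hp : IsProb p) {u w : V} (hu : u ≠ x) (hw : w ≠ x) :
    G.SureConn p u w ↔ (G.seriesGraph e₁ y z).SureConn (serWeight p e₁ e₂) u w := by
  unfold SureConn
  rw [sureConfig_serWeight hp hs.ne]
  exact hs.conn_iff _ hu hw

end MultiGraph

/-- **Lemma 5 (free-edge form) for two-terminal-REDUCED instances only.** -/
def Concavity5SureReduced : Prop :=
  ∀ {V E : Type} [Fintype E] [DecidableEq E] (G : MultiGraph V E) (p : E → ℝ), IsProb p →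
    ∀ (a b c d : V), [a, b, c, d].Nodup → ∀ g : E, IsFree p g →
      (∃ m, (m = a ∨ m = b ∨ m = c ∨ m = d) ∧
        (G.SureConn p (G.fst g) m ∨ G.SureConn p (G.snd g) m)) →
      ¬ HasReduciblePair G p g a b c d → G.deltaQuad p g a b c d ≤ 0

/-- **WLOG two-terminal-reduced for Lemma 5**: Lemma 5 on reduced instances gives Lemma 5 in
free-edge form (strong induction on the live edges; the substitutions keep `g` free and keep its
endpoint sure-connected to the mark). -/
theorem Concavity5Sure_of_reduced (h : Concavity5SureReduced) : Concavity5Sure := by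
  intro V E _ _ G p hp a b c d hn g hg hm
  rw [G.concaveOn_phiPlus_iff]
  suffices key : ∀ n : ℕ, ∀ (G : MultiGraph V E) (q : E → ℝ), IsProb q → (liveEdges q).card = n →
      IsFree q g → (∃ m, (m = a ∨ m = b ∨ m = c ∨ m = d) ∧
        (G.SureConn q (G.fst g) m ∨ G.SureConn q (G.snd g) m)) →
      G.deltaQuad q g a b c d ≤ 0 from key _ G p hp rfl hg hm
  intro n
  induction n using Nat.strong_induction_on with
  | _ n ih =>
    intro G q hq hcard hgq hmq
    by_cases hred : HasReduciblePair G q g a b c d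
    · rcases hred with ⟨e₁, e₂, hne, hpar, h₁, h₂, hg₁, hg₂⟩ |
        ⟨e₁, e₂, x, y, z, hs, h₁, h₂, hg₁, hg₂, ha, hb, hc, hd⟩
      · have hlt : (liveEdges (parWeight q e₁ e₂)).card < n := by
          rw [← hcard]
          exact Finset.card_lt_card (liveEdges_parWeight_ssubset hne h₁ h₂)
        have hfree : IsFree (parWeight q e₁ e₂) g := by
          unfold IsFree parWeight
          rw [Function.update_of_ne hg₁, Function.update_of_ne hg₂]
          exact hgq
        have hmark : ∃ m, (m = a ∨ m = b ∨ m = c ∨ m = d) ∧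
            (G.SureConn (parWeight q e₁ e₂) (G.fst g) m ∨
              G.SureConn (parWeight q e₁ e₂) (G.snd g) m) := by
          obtain ⟨m, hm₁, hm₂⟩ := hmq
          refine ⟨m, hm₁, ?_⟩
          rw [G.sureConn_parWeight_iff hq hne hpar, G.sureConn_parWeight_iff hq hne hpar]
          exact hm₂
        rw [G.deltaQuad_parallel hne hpar q hg₁ hg₂]
        exact ih _ hlt G _ (isProb_parWeight hq e₁ e₂) rfl hfree hmark
      · have hlt : (liveEdges (serWeight q e₁ e₂)).card < n := by
          rw [← hcard]
          exact Finset.card_lt_card (liveEdges_serWeight_ssubset hs.ne h₁ h₂)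
        have hfree : IsFree (serWeight q e₁ e₂) g := by
          unfold IsFree serWeight
          rw [Function.update_of_ne hg₁, Function.update_of_ne hg₂]
          exact hgq
        have hgx := hs.ne_of_ne hg₁ hg₂
        have hmark : ∃ m, (m = a ∨ m = b ∨ m = c ∨ m = d) ∧
            ((G.seriesGraph e₁ y z).SureConn (serWeight q e₁ e₂) ((G.seriesGraph e₁ y z).fst g) m ∨
              (G.seriesGraph e₁ y z).SureConn (serWeight q e₁ e₂)
                ((G.seriesGraph e₁ y z).snd g) m) := by
          obtain ⟨m, hm₁, hm₂⟩ := hmq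
          have hmx : m ≠ x := by
            rcases hm₁ with rfl | rfl | rfl | rfl <;> assumption
          refine ⟨m, hm₁, ?_⟩
          rw [G.seriesGraph_fst_of_ne hg₁, G.seriesGraph_snd_of_ne hg₁,
            ← hs.sureConn_iff hq hgx.1 hmx, ← hs.sureConn_iff hq hgx.2 hmx]
          exact hm₂
        rw [hs.deltaQuad q hg₁ hg₂ ha hb hc hd]
        exact ih _ hlt _ _ (isProb_serWeight hq e₁ e₂) rfl hfree hmark
    · exact h G q hq a b c d hn g hgq hmq hred

/-- **C-005⁺ from Lemma 5 on reduced instances.** -/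
theorem C011_of_Concavity5SureReduced (h : Concavity5SureReduced) : C011 :=
  C011_of_Concavity5Sure (Concavity5Sure_of_reduced h)

/-- **C-005 from Lemma 5 on reduced instances.** -/
theorem C005_of_Concavity5SureReduced (h : Concavity5SureReduced) : C005 :=
  C005_of_C011 (C011_of_Concavity5SureReduced h)

end PercRepro
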